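import Literature.IUT.HodgeArakelov.EtaleThetaDataOfSettingTateTwist
import Literature.AnabelianGeometry.EtaleTheta.CyclotomeTowerAllLevels
import Literature.AnabelianGeometry.EtaleTheta.Discharge.Sec1DeltaThetaDivisible

/-!
# [IUTchII] Prop 1.4 / Cor 1.12 (c) / Prop 2.2 (ii) at the model `Π = Π^tp_X̲̲`: the «cyclotomic
# no-invariants» hypothesis `hfix` from the cyclotome tower `μ_M ≅ (l·Δ_Θ) ⊗ ℤ/Mℤ` ([EtTh] Cor 2.19 (ii))

S. Mochizuki, *Inter-universal Teichmüller theory II*, Prop. 1.4 p. 27 / Cor. 1.12 (c) p. 56 /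
Prop. 2.2 (ii) p. 66, at the MODEL `D := etaleThetaDataOfSetting'` (abc-iut-L6-t1) over the [EtTh] data
`D : ThetaSetting p`, `E : D.EtaleThetaData`, `C : E.DoubleUnderline l`.  Sequel of
`EtaleThetaDataOfSettingTateTwist.lean` (same seat), where the binder

  `hfix : ∀ K' ≤ Π^tp_X̲̲` of finite index, `∀ a ∈ l·Δ_Θ`, `(∀ n ∈ Π^tp_Ÿ̲̲ ∩ K', φ(n) a φ(n)⁻¹ = a) → a = 1`

of `toLim_top_injective_of_forall_fixed_eq_one` / `inftyClause_(uniqueness_)etaleThetaDataOfSetting'`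
(abc-iut-w5-d187) and `h1LimRestrict_injective_of_forall_fixed_eq_one` (abc-iut-w4-d041 g0) was derived from
a raw Tate-twist datum.  HERE that datum is REPLACED BY EXISTING TYPED [EtTh] §2 VOCABULARY: a
`ThetaSetting.CyclotomeTower l E` (abc-iut-L2-t8, `TowerOfSetting.lean`: "the natural isomorphism
`μ_N ≅ (l·Δ_Θ) ⊗ (ℤ/Nℤ)`" of Def. 2.13 at every level of a cofinal chain `E ∋ 1`, compatible with the power
maps — [EtTh] Cor. 2.19 (ii) p. 64; extended to ALL levels `M ∈ ℕ≥1` by `CyclotomeTower.modAll` /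
`red_modAll`, `CyclotomeTowerAllLevels.lean`) together with the freeness guard `IsEtThOrigin` of
`Setting.lean` ("`Δ_X` is a profinite free group on 2 generators", p. 12):

  **`hfix_of_cyclotomeTower : D.IsEtThOrigin → D.CyclotomeTower l E → hfix`**.

Proof.  Let `a ∈ l·Δ_Θ` be fixed by `Π^tp_Ÿ̲̲ ∩ K'`.  By equivariance (`CyclotomeMod.red_conj`) the
reductions `ζ_M := red_M(a) ∈ μ_M(ℚ̄_p)` form a COMPATIBLE family of roots of unity (`red_modAll`) fixed by
`aug(Π^tp_Ÿ̲̲ ∩ K')`, a subgroup of finite index in the open subgroup `G_K = aug(Π^tp_Ÿ̲̲)` of `G_{ℚ_p}`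
([EtTh] Prop 2.2 (iii): `DoubleUnderline.map_aug_Ydduu`); hence `ζ_M = 1` for all `M`
(`padicAlgCl_compatibleRoots_eq_one_of_finiteIndex_in_fixingSubgroup`, `CyclotomeGaloisFixedPoints.lean`:
a `p`-adic field has finitely many roots of unity); so `a` is an `M`-th power in `l·Δ_Θ` for every `M`
(`CyclotomeMod.red_ker`), hence `a = 1` because the tempered `l·Δ_Θ` has no infinitely divisible elements
(`ThetaSetting.lDeltaTheta_eq_one_of_forall_exists_pow_eq`, `Discharge/Sec1DeltaThetaDivisible.lean`:
`Δ_Θ ↪ [Δ_X,Δ_X]⁻/[[Δ_X,Δ_X],Δ_X]⁻ ≅ Ẑ` under `IsEtThOrigin`, and `⋂_M Ẑ^M = 1` from the tree's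
`ZHatCompletionAdicCompleteness.lean`).

Corollaries: `toLim_top_injective_of_cyclotomeTower`, `inftyClause_uniqueness_of_cyclotomeTower`,
`inftyClause_of_cyclotomeTower` — the three consumers with `hfix` DISCHARGED modulo
{`IsEtThOrigin`, a `CyclotomeTower`} (both already carried by the [EtTh] §2 consumers of the tree; no new
Prop fact, no new datum).  This disposes of the cell's GAP-LEDGER row G-w4d041-1 half (B) WITHOUT a new
field on the root interface.  Proof-only (0 definitions).  [EtTh] is refereed; the [IUTchII] claim key is
`Mochizuki2012` (disputed); nothing here bears on [IUTchIII] Cor. 3.12; typed ≠ proved.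
-/

noncomputable section

namespace Literature.IUT.HodgeArakelov

namespace EtaleThetaDataOfSetting

open Literature.AnabelianGeometry.EtaleTheta Literature.AnabelianGeometry.SemiGraphs

variable {p : ℕ} [Fact p.Prime] {D : Literature.AnabelianGeometry.EtaleTheta.ThetaSetting p}
  {E : D.EtaleThetaData} {l : ℕ} (C : E.DoubleUnderline l) {Es : Set ℕ+}

/-- Finite relative index is preserved by taking images (bookkeeping). [folklore] -/
private theorem finiteIndex_subgroupOf_map' {G G' : Type*} [Group G] [Group G'] (f : G →* G')
    (H P : Subgroup G) (hHP : H ≤ P) [hfin : (H.subgroupOf P).FiniteIndex] :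
    ((H.map f).subgroupOf (P.map f)).FiniteIndex := by
  have hsurj : Function.Surjective (f.subgroupMap P) := f.subgroupMap_surjective P
  have heq : (H.subgroupOf P).map (f.subgroupMap P) = (H.map f).subgroupOf (P.map f) := by
    ext ⟨y, hy⟩
    simp only [Subgroup.mem_map, Subgroup.mem_subgroupOf]
    constructor
    · rintro ⟨⟨x, hxP⟩, hxH, hxy⟩
      exact ⟨x, hxH, congrArg Subtype.val hxy⟩
    · rintro ⟨x, hxH, hxy⟩
      exact ⟨⟨x, hHP hxH⟩, hxH, Subtype.ext hxy⟩
  refine ⟨fun h0 => hfin.index_ne_zero ?_⟩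
  have hdvd := Subgroup.index_map_dvd (H.subgroupOf P) hsurj
  rw [heq, h0] at hdvd
  exact Nat.eq_zero_of_zero_dvd hdvd

/-- **`aug(Π^tp_Ÿ̲̲ ∩ K')` has finite index in `G_K`** for every `K' ≤ Π^tp_X̲̲` of finite index
(`aug(Π^tp_Ÿ̲̲) = G_K`, [EtTh] Prop 2.2 (iii) via `map_aug_PiYdd`). [cite: MochizukiEtTh2009, Prop 2.2 (iii) p.37] -/
theorem finiteIndex_map_aug_PiYdd_inf (K' : Subgroup (Pi C)) [K'.FiniteIndex] :
    ((((PiYdd C ⊓ K').map (D.aug.toMonoidHom.comp C.Huu.subtype)) : Subgroup (GQp p)).subgroupOf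
      D.GK).FiniteIndex := by
  haveI : ((PiYdd C ⊓ K').subgroupOf (PiYdd C)).FiniteIndex := by
    rw [Subgroup.inf_subgroupOf_left]
    infer_instance
  have h := finiteIndex_subgroupOf_map' (D.aug.toMonoidHom.comp C.Huu.subtype)
    (PiYdd C ⊓ K') (PiYdd C) inf_le_left
  rw [map_aug_PiYdd] at h
  exact h

/-- **The «cyclotomic no-invariants» hypothesis at the model from the cyclotome tower** ([IUTchII]
Prop 1.4 p. 27 "`J` ranges over the finite index open subgroups of `Π`"; [EtTh] §1 p. 12 "`(Ẑ(1) ≅) Δ_Θ`",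
Cor. 2.19 (ii) p. 64): under the freeness guard `IsEtThOrigin` and given a `CyclotomeTower`
(`μ_M ≅ (l·Δ_Θ) ⊗ ℤ/Mℤ` along a cofinal chain, abc-iut-L2-t8), every element of `l·Δ_Θ` fixed by
`Π^tp_Ÿ̲̲ ∩ K'` (`K' ≤ Π^tp_X̲̲` of finite index) is trivial. [cite: MochizukiEtTh2009, Cor 2.19 (ii) p.64] -/
theorem forall_conj_fixed_eq_one_of_cyclotomeTower (hO : D.IsEtThOrigin) (τ : D.CyclotomeTower l Es)
    (K' : Subgroup (Pi C)) [K'.FiniteIndex] (a : ↥(D.lDeltaTheta l))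
    (ha : ∀ n : Pi C, n ∈ PiYdd C ⊓ K' → MulAut.conjNormal (phi C n) a = a) : a = 1 := by
  classical
  haveI : FiniteDimensional ℚ_[p] D.K := D.finiteDimensional_K
  set f : (Pi C) →* GQp p := D.aug.toMonoidHom.comp C.Huu.subtype with hfdef
  set U : Subgroup (GQp p) := (PiYdd C ⊓ K').map f with hUdef
  haveI : (U.subgroupOf D.K.fixingSubgroup).FiniteIndex := finiteIndex_map_aug_PiYdd_inf C K'
  -- the compatible family of roots of unity `ζ_M := red_M(a)`
  set ζ : ℕ → PadicAlgCl p := fun n =>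
    if h : 0 < n then ((((τ.modAll ⟨n, h⟩).red a : MuN p ⟨n, h⟩) : (PadicAlgCl p)ˣ) : PadicAlgCl p)
    else 1 with hζ
  have hcompat : ∀ n m : ℕ, 0 < n → 0 < m → ζ (n * m) ^ m = ζ n := by
    intro n m hn hm
    have hnm : 0 < n * m := Nat.mul_pos hn hm
    simp only [hζ, dif_pos hn, dif_pos hnm]
    have hdvd : ((⟨n, hn⟩ : ℕ+) : ℕ) ∣ ((⟨n * m, hnm⟩ : ℕ+) : ℕ) := Dvd.intro m rfl
    have h := congrArg (fun z : MuN p ⟨n, hn⟩ => ((z : (PadicAlgCl p)ˣ) : PadicAlgCl p))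
      (τ.red_modAll ⟨n, hn⟩ ⟨n * m, hnm⟩ hdvd a)
    simp only [MuN.coe_red, PNat.mk_coe, Units.val_pow_eq_pow_val] at h
    rw [Nat.mul_div_cancel_left m hn] at h
    exact h
  have htor : ∀ n, 0 < n → ζ n ^ n = 1 := by
    intro n hn
    simp only [hζ, dif_pos hn]
    have hmem := (((τ.modAll ⟨n, hn⟩).red a : MuN p ⟨n, hn⟩)).2
    rw [mem_rootsOfUnity] at hmem
    have hmem' : (((τ.modAll ⟨n, hn⟩).red a : MuN p ⟨n, hn⟩) : (PadicAlgCl p)ˣ) ^ n = 1 := hmem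
    rw [← Units.val_pow_eq_pow_val, hmem', Units.val_one]
  -- fixed by `U = aug(Π^tp_Ÿ̲̲ ∩ K')`, by the equivariance of the cyclotome identifications
  have hfixζ : ∀ σ ∈ U, ∀ n, 0 < n → σ (ζ n) = ζ n := by
    intro σ hσ n hn
    rw [hUdef] at hσ
    obtain ⟨g, hg, rfl⟩ := Subgroup.mem_map.mp hσ
    simp only [hζ, dif_pos hn]
    have ha' : MulAut.conjNormal (D.toTheta (g : D.PiTemp)) a = a := ha g hg
    have hc : (τ.modAll ⟨n, hn⟩).red (MulAut.conjNormal (D.toTheta (g : D.PiTemp)) a) =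
        galMuN p ⟨n, hn⟩ (D.aug.toMonoidHom (g : D.PiTemp)) ((τ.modAll ⟨n, hn⟩).red a) :=
      (τ.modAll ⟨n, hn⟩).red_conj (g : D.PiTemp) a
    rw [ha'] at hc
    have h2 := congrArg (fun z : MuN p ⟨n, hn⟩ => ((z : (PadicAlgCl p)ˣ) : PadicAlgCl p)) hc
    simp only [galMuN_apply_coe] at h2
    change (D.aug (g : D.PiTemp)) _ = _
    exact h2.symm
  have hone := padicAlgCl_compatibleRoots_eq_one_of_finiteIndex_in_fixingSubgroup p D.K U ζ
    hcompat htor hfixζ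
  -- every reduction `red_M(a)` is `1`, so `a` is infinitely divisible in `l·Δ_Θ`, hence trivial
  refine D.lDeltaTheta_eq_one_of_forall_exists_pow_eq hO a fun M => ?_
  have hM := hone M M.pos
  simp only [hζ, dif_pos M.pos] at hM
  have hred : (τ.modAll M).red a = 1 :=
    Subtype.ext (Units.val_eq_one.mp hM)
  exact ((τ.modAll M).red_ker a).mp hred

/-- **`hfix` from the cyclotome tower**, in the exact binder shape of the consumers.
[cite: MochizukiEtTh2009, Cor 2.19 (ii) p.64] -/
theorem hfix_of_cyclotomeTower (hO : D.IsEtThOrigin) (τ : D.CyclotomeTower l Es) :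
    ∀ K' : Subgroup (Pi C), K'.FiniteIndex → ∀ a : ↥(D.lDeltaTheta l),
      (∀ n : Pi C, n ∈ PiYdd C ⊓ K' → MulAut.conjNormal (phi C n) a = a) → a = 1 :=
  fun K' hK' a ha => by
    haveI := hK'
    exact forall_conj_fixed_eq_one_of_cyclotomeTower C hO τ K' a ha

/-- **[IUTchII] Cor 1.12 (c) / Prop 1.4 at the model**: `H¹(Π^tp_Ÿ̲̲, l·Δ_Θ) → lim_J H¹(Π^tp_Ÿ̲̲ ∩ J, l·Δ_Θ)`
is INJECTIVE, given `IsEtThOrigin` and a `CyclotomeTower` (abc-iut-w5-d187's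
`toLim_top_injective_of_forall_fixed_eq_one`, `hfix` discharged). [claim: Mochizuki2012, status: disputed]
(IUTchII Cor 1.12 (c) p.56 "natural inclusion") -/
theorem toLim_top_injective_of_cyclotomeTower (hO : D.IsEtThOrigin) (τ : D.CyclotomeTower l Es) :
    Function.Injective ((coh C).toLim ⊤) :=
  toLim_top_injective_of_forall_fixed_eq_one (phi C) (D.lDeltaTheta l) (PiYdd C)
    (hfix_of_cyclotomeTower C hO τ)

/-- **[IUTchII] Prop 2.2 (ii) «respectively» clause, clauses (1)(2), at the model**, given `IsEtThOrigin` and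
a `CyclotomeTower` (instead of `hfix`): `∞θ^ι(Π_v)` is nonempty and two members with a common root level
differ by a torsion class (abc-iut-w5-d187's `inftyClause_uniqueness_etaleThetaDataOfSetting'`, `hfix`
discharged). [claim: Mochizuki2012, status: disputed] (IUTchII §2 Prop 2.2 (ii), kurims p.66) -/
theorem inftyClause_uniqueness_of_cyclotomeTower (hO : D.IsEtThOrigin) (τ : D.CyclotomeTower l Es)
    (hC : D.Compat) (hS : D.Sec2Hyps) (hchar : PiYddCharacteristic C) (S : BadPlaceSetting.{0})
    (eS : (Pi C) ≃ₜ* S.PiX) (hl : S.l = l) {T : TemperedCoverings S (Pi C)}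
    {Dec : SubgraphDecomposition S T (etaleThetaDataOfSetting' C hC hS hchar S.toThetaSetting eS hl)}
    (Θ : IotaInvariantTheta' Dec) :
    Θ.thetaInftyIota.Nonempty ∧
      ∀ x ∈ Θ.thetaInftyIota, ∀ x' ∈ Θ.thetaInftyIota,
        (etaleThetaDataOfSetting' C hC hS hchar S.toThetaSetting eS hl).SameRootLevel x x' →
          IsOfFinAddOrder (x - x') :=
  inftyClause_uniqueness_etaleThetaDataOfSetting' C hC hS hchar S eS hl Θ (hfix_of_cyclotomeTower C hO τ)

/-- **[IUTchII] Prop 2.2 (ii) «respectively» clause IN FULL at the model**, given `IsEtThOrigin`, a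
`CyclotomeTower`, and (hdiv) the divisibility of the theta classes in the limit (abc-iut-w5-d187's
`inftyClause_etaleThetaDataOfSetting'`, `hfix` discharged). [claim: Mochizuki2012, status: disputed]
(IUTchII §2 Prop 2.2 (ii), kurims p.66) -/
theorem inftyClause_of_cyclotomeTower (hO : D.IsEtThOrigin) (τ : D.CyclotomeTower l Es)
    (hC : D.Compat) (hS : D.Sec2Hyps) (hchar : PiYddCharacteristic C) (S : BadPlaceSetting.{0})
    (eS : (Pi C) ≃ₜ* S.PiX) (hl : S.l = l) {T : TemperedCoverings S (Pi C)}
    {Dec : SubgraphDecomposition S T (etaleThetaDataOfSetting' C hC hS hchar S.toThetaSetting eS hl)}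
    (Θ : IotaInvariantTheta' Dec)
    (hdiv : ∀ t ∈ (etaleThetaDataOfSetting' C hC hS hchar S.toThetaSetting eS hl).theta, ∀ N : ℕ, 0 < N →
      ∃ x : (coh C).lim, N • x = (coh C).toLim ⊤ t) :
    Θ.InftyClause :=
  inftyClause_etaleThetaDataOfSetting' C hC hS hchar S eS hl Θ (hfix_of_cyclotomeTower C hO τ) hdiv

end EtaleThetaDataOfSetting

end Literature.IUT.HodgeArakelov
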